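import Mathlib
import Summits.AtomisticToContinuum.FouriersLaw.Theses.EmbeddedDrudeMourre
import Summits.AtomisticToContinuum.FouriersLaw.Theorems.EmbeddedDrudeMourreDrudeDissolutionStubExcursionSecondDifferenceFloorLocalComoving
import HarnessLib

/-!
# The local Morse–Bott gradient floor near the co-moving curve of the SECOND exchange plane
# (stub B1b″ of line `kinetic-polymer-gas-on-the-time-axis`, step L3₂ of the gradient floor (C4))
(crux `EmbeddedDrudeMourre.DrudeDissolution`, item stmt-AtomisticToContinuum-12593; `--supports` file, closes
nothing; lead c13)

WHAT. `gradient_floor_local_comoving_snd`: the mirror image of `gradient_floor_local_comoving` under the exchange of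
the two planes: `Ω = σ·A·S₁·S₂` (`σ = ±1`, `A ∈ C¹`); at `p₀` with `S₂ p₀ = 0`, `A p₀ = 0`, `S₁ p₀ ≠ 0` and `A`
tangentially non-degenerate along the second plane `{p.2.1 = p.2.2}` (`∂A/∂(1,0,0) ≠ 0` or `∂A/∂(0,1,1) ≠ 0`), there
are `r, c > 0` with `c·((A p)² + (S₂ p)²) ≤ Σⱼ(∂ⱼΩ p)²` on `dist p p₀ < r`.

HOW. The algebra `gradient_floor_local_alg` is invariant under `(S₁,c₁,a₁) ↔ (S₂,c₂,a₃)` up to the order of the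
three squares; the continuity part is copied with the roles exchanged.
-/

noncomputable section

open Set Real Topology Metric
open Literature.MathematicalPhysics.KineticTheory
open Literature.MathematicalPhysics.KineticTheory.PhononBoltzmann

namespace Summit.AtomisticToContinuum.FouriersLaw.Theorems.DrudeDissolution.KineticPolymerGasOnTheTimeAxis


/-- **Registered sub-goal `gradient_floor_local_comoving_snd` (L3₂ of the gradient floor): the local Morse–Bott
floor at a non-degenerate point of the co-moving curve of the second exchange plane.** Let
`Ω q = σ·A q·sin((q.2.1−q.1)/2)·sin((q.2.1−q.2.2)/2)` with `σ = ±1` and `A ∈ C¹`. If `sin((p₀.2.1−p₀.2.2)/2) = 0`,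
`A p₀ = 0`, `sin((p₀.2.1−p₀.1)/2) ≠ 0` and `fderiv A p₀ (1,0,0) ≠ 0 ∨ fderiv A p₀ (0,1,1) ≠ 0`, then there are
`r, c > 0` such that for `dist p p₀ < r`:
`c·((A p)² + sin²((p.2.1−p.2.2)/2)) ≤ (fderiv Ω p (1,0,0))² + (fderiv Ω p (0,1,0))² + (fderiv Ω p (0,0,1))²`.
[folklore] -/
theorem gradient_floor_local_comoving_snd :
    ∀ (Ω A : ℝ × ℝ × ℝ → ℝ) (σ : ℝ) (p₀ : ℝ × ℝ × ℝ), (σ = 1 ∨ σ = -1) → ContDiff ℝ 1 A →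
      (∀ q, Ω q = σ * A q * Real.sin ((q.2.1 - q.1) / 2) * Real.sin ((q.2.1 - q.2.2) / 2)) →
      Real.sin ((p₀.2.1 - p₀.2.2) / 2) = 0 → A p₀ = 0 → Real.sin ((p₀.2.1 - p₀.1) / 2) ≠ 0 →
      (fderiv ℝ A p₀ (1, 0, 0) ≠ 0 ∨ fderiv ℝ A p₀ (0, 1, 1) ≠ 0) →
      ∃ r c : ℝ, 0 < r ∧ 0 < c ∧ ∀ p : ℝ × ℝ × ℝ, dist p p₀ < r →
        c * ((A p) ^ 2 + Real.sin ((p.2.1 - p.2.2) / 2) ^ 2) ≤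
          (fderiv ℝ Ω p (1, 0, 0)) ^ 2 + (fderiv ℝ Ω p (0, 1, 0)) ^ 2 + (fderiv ℝ Ω p (0, 0, 1)) ^ 2 := by
  intro Ω A σ p₀ hσ hA hΩ hS₂ hA0 hS₁ htan
  have hσ2 : σ ^ 2 = 1 := by rcases hσ with h | h <;> rw [h] <;> norm_num
  -- continuity of the ingredients
  have hAc : Continuous A := hA.continuous
  have hAd : ∀ p, DifferentiableAt ℝ A p := fun p => (hA.differentiable one_ne_zero) p
  have hfd : Continuous fun p => fderiv ℝ A p := hA.continuous_fderiv one_ne_zero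
  have ha : ∀ e : ℝ × ℝ × ℝ, Continuous fun p => fderiv ℝ A p e := fun e =>
    (ContinuousLinearMap.apply ℝ ℝ e).continuous.comp hfd
  have cS₁ : Continuous fun p : ℝ × ℝ × ℝ => Real.sin ((p.2.1 - p.1) / 2) := by fun_prop
  have cc₁ : Continuous fun p : ℝ × ℝ × ℝ => Real.cos ((p.2.1 - p.1) / 2) := by fun_prop
  have cc₂ : Continuous fun p : ℝ × ℝ × ℝ => Real.cos ((p.2.1 - p.2.2) / 2) := by fun_prop
  -- the three auxiliary functions
  set g : ℝ × ℝ × ℝ → ℝ := fun p => (Real.sin ((p.2.1 - p.1) / 2) * Real.cos ((p.2.1 - p.2.2) / 2)) ^ 2 with hg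
  set h : ℝ × ℝ × ℝ → ℝ := fun p => |Real.sin ((p.2.1 - p.1) / 2) *
      (fderiv ℝ A p (0, 1, 0) - fderiv ℝ A p (0, 0, 1)) + A p * Real.cos ((p.2.1 - p.1) / 2) / 2| with hh
  set k : ℝ × ℝ × ℝ → ℝ := fun p => (Real.sin ((p.2.1 - p.1) / 2) * (fderiv ℝ A p (0, 0, 1) + fderiv ℝ A p (0, 1, 0)) +
      A p * Real.cos ((p.2.1 - p.1) / 2) / 2) ^ 2 +
    (Real.sin ((p.2.1 - p.1) / 2) * fderiv ℝ A p (1, 0, 0) - A p * Real.cos ((p.2.1 - p.1) / 2) / 2) ^ 2 with hk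
  have cg : Continuous g := by rw [hg]; exact (cS₁.mul cc₂).pow 2
  have ch : Continuous h := by
    rw [hh]; exact ((cS₁.mul ((ha _).sub (ha _))).add ((hAc.mul cc₁).div_const 2)).abs
  have ck : Continuous k := by
    rw [hk]
    exact (((cS₁.mul ((ha _).add (ha _))).add ((hAc.mul cc₁).div_const 2)).pow 2).add
      (((cS₁.mul (ha _)).sub ((hAc.mul cc₁).div_const 2)).pow 2)
  -- values at `p₀`
  have hc₂0 : Real.cos ((p₀.2.1 - p₀.2.2) / 2) ^ 2 = 1 := by
    have := Real.sin_sq_add_cos_sq ((p₀.2.1 - p₀.2.2) / 2)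
    rw [hS₂] at this; linarith
  have hg0 : 0 < g p₀ := by
    have e : g p₀ = Real.sin ((p₀.2.1 - p₀.1) / 2) ^ 2 * Real.cos ((p₀.2.1 - p₀.2.2) / 2) ^ 2 := by
      simp only [hg, mul_pow]
    rw [e, hc₂0, mul_one]
    positivity
  have hk0 : 0 < k p₀ := by
    have hadd : fderiv ℝ A p₀ (0, 0, 1) + fderiv ℝ A p₀ (0, 1, 0) = fderiv ℝ A p₀ (0, 1, 1) := by
      rw [← map_add]; norm_num
    have e : k p₀ = (Real.sin ((p₀.2.1 - p₀.1) / 2) * fderiv ℝ A p₀ (0, 1, 1)) ^ 2 +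
        (Real.sin ((p₀.2.1 - p₀.1) / 2) * fderiv ℝ A p₀ (1, 0, 0)) ^ 2 := by
      simp only [hk]
      rw [hA0, ← hadd]
      ring
    rw [e]
    rcases htan with h1 | h3
    · have : 0 < (Real.sin ((p₀.2.1 - p₀.1) / 2) * fderiv ℝ A p₀ (1, 0, 0)) ^ 2 := by positivity
      nlinarith [sq_nonneg (Real.sin ((p₀.2.1 - p₀.1) / 2) * fderiv ℝ A p₀ (0, 1, 1))]
    · have : 0 < (Real.sin ((p₀.2.1 - p₀.1) / 2) * fderiv ℝ A p₀ (0, 1, 1)) ^ 2 := by positivity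
      nlinarith [sq_nonneg (Real.sin ((p₀.2.1 - p₀.1) / 2) * fderiv ℝ A p₀ (1, 0, 0))]
  -- balls
  obtain ⟨r₁, hr₁, hb₁⟩ := exists_ball_gt_of_continuousAt cg.continuousAt (half_lt_self hg0)
  obtain ⟨r₂, hr₂, hb₂⟩ := exists_ball_lt_of_continuousAt ch.continuousAt (lt_add_one (h p₀))
  obtain ⟨r₃, hr₃, hb₃⟩ := exists_ball_gt_of_continuousAt ck.continuousAt (half_lt_self hk0)
  -- constants
  set g₀ := g p₀ / 2 with hg₀
  set H := h p₀ + 1 with hH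
  set κ := k p₀ / 2 with hκ
  have hHpos : 0 < H := by rw [hH]; have : 0 ≤ h p₀ := abs_nonneg _; linarith
  have hκpos : 0 < κ := by rw [hκ]; linarith
  set θ := min 1 (κ / (2 * H ^ 2)) with hθ
  have hθ0 : 0 < θ := by rw [hθ]; exact lt_min one_pos (by positivity)
  have hθ1 : θ ≤ 1 := min_le_left _ _
  have hθH : 2 * θ * H ^ 2 ≤ κ := by
    have : θ ≤ κ / (2 * H ^ 2) := min_le_right _ _
    have h2 : 0 < 2 * H ^ 2 := by positivity
    calc 2 * θ * H ^ 2 = θ * (2 * H ^ 2) := by ring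
      _ ≤ κ / (2 * H ^ 2) * (2 * H ^ 2) := mul_le_mul_of_nonneg_right this h2.le
      _ = κ := by field_simp
  refine ⟨min r₁ (min r₂ r₃), min (θ * g₀ / 4) (κ / 4), lt_min hr₁ (lt_min hr₂ hr₃),
    lt_min (by positivity) (by positivity), fun p hp => ?_⟩
  have hp₁ : dist p p₀ < r₁ := lt_of_lt_of_le hp (min_le_left _ _)
  have hp₂ : dist p p₀ < r₂ := lt_of_lt_of_le hp ((min_le_right _ _).trans (min_le_left _ _))
  have hp₃ : dist p p₀ < r₃ := lt_of_lt_of_le hp ((min_le_right _ _).trans (min_le_right _ _))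
  -- the partials at `p`
  obtain ⟨e11, e12, e13⟩ := fderiv_S1_apply p
  obtain ⟨e21, e22, e23⟩ := fderiv_S2_apply p
  have d1 := fderiv_factorised_apply Ω A σ p (1, 0, 0) (hAd p) hΩ
  have d2 := fderiv_factorised_apply Ω A σ p (0, 1, 0) (hAd p) hΩ
  have d3 := fderiv_factorised_apply Ω A σ p (0, 0, 1) (hAd p) hΩ
  rw [e11, e21] at d1
  rw [e12, e22] at d2
  rw [e13, e23] at d3
  rw [d1, d2, d3]
  have halg := gradient_floor_local_alg (σ := σ) (A := A p) (S₁ := Real.sin ((p.2.1 - p.2.2) / 2))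
    (S₂ := Real.sin ((p.2.1 - p.1) / 2)) (c₁ := Real.cos ((p.2.1 - p.2.2) / 2)) (c₂ := Real.cos ((p.2.1 - p.1) / 2))
    (a₁ := fderiv ℝ A p (0, 0, 1)) (a₂ := fderiv ℝ A p (0, 1, 0)) (a₃ := fderiv ℝ A p (1, 0, 0))
    (g₀ := g₀) (H := H) (κ := κ) (θ := θ) hσ2 (le_of_lt (hb₁ p hp₁)) (le_of_lt (hb₂ p hp₂))
    (le_of_lt (hb₃ p hp₃)) hθ0 hθ1 hθH
  -- the mirrored algebra lists the three squares in the order `(∂₃, ∂₂, ∂₁)`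
  have hperm : (σ * (Real.sin ((p.2.1 - p.2.2) / 2) * Real.sin ((p.2.1 - p.1) / 2) * fderiv ℝ A p (0, 0, 1) +
        A p * Real.sin ((p.2.1 - p.1) / 2) * (-(Real.cos ((p.2.1 - p.2.2) / 2) / 2)) +
        A p * Real.sin ((p.2.1 - p.2.2) / 2) * 0)) ^ 2 +
      (σ * (Real.sin ((p.2.1 - p.2.2) / 2) * Real.sin ((p.2.1 - p.1) / 2) * fderiv ℝ A p (0, 1, 0) +
        A p * Real.sin ((p.2.1 - p.1) / 2) * (Real.cos ((p.2.1 - p.2.2) / 2) / 2) +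
        A p * Real.sin ((p.2.1 - p.2.2) / 2) * (Real.cos ((p.2.1 - p.1) / 2) / 2))) ^ 2 +
      (σ * (Real.sin ((p.2.1 - p.2.2) / 2) * Real.sin ((p.2.1 - p.1) / 2) * fderiv ℝ A p (1, 0, 0) +
        A p * Real.sin ((p.2.1 - p.1) / 2) * 0 +
        A p * Real.sin ((p.2.1 - p.2.2) / 2) * (-(Real.cos ((p.2.1 - p.1) / 2) / 2)))) ^ 2 =
      (σ * (Real.sin ((p.2.1 - p.1) / 2) * Real.sin ((p.2.1 - p.2.2) / 2) * fderiv ℝ A p (1, 0, 0) +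
        A p * Real.sin ((p.2.1 - p.2.2) / 2) * (-(Real.cos ((p.2.1 - p.1) / 2) / 2)) +
        A p * Real.sin ((p.2.1 - p.1) / 2) * 0)) ^ 2 +
      (σ * (Real.sin ((p.2.1 - p.1) / 2) * Real.sin ((p.2.1 - p.2.2) / 2) * fderiv ℝ A p (0, 1, 0) +
        A p * Real.sin ((p.2.1 - p.2.2) / 2) * (Real.cos ((p.2.1 - p.1) / 2) / 2) +
        A p * Real.sin ((p.2.1 - p.1) / 2) * (Real.cos ((p.2.1 - p.2.2) / 2) / 2))) ^ 2 +
      (σ * (Real.sin ((p.2.1 - p.1) / 2) * Real.sin ((p.2.1 - p.2.2) / 2) * fderiv ℝ A p (0, 0, 1) +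
        A p * Real.sin ((p.2.1 - p.2.2) / 2) * 0 +
        A p * Real.sin ((p.2.1 - p.1) / 2) * (-(Real.cos ((p.2.1 - p.2.2) / 2) / 2)))) ^ 2 := by ring
  rw [hperm] at halg
  refine le_trans ?_ halg
  have hA2 := sq_nonneg (A p)
  have hS2 := sq_nonneg (Real.sin ((p.2.1 - p.2.2) / 2))
  calc min (θ * g₀ / 4) (κ / 4) * (A p ^ 2 + Real.sin ((p.2.1 - p.2.2) / 2) ^ 2)
      = min (θ * g₀ / 4) (κ / 4) * A p ^ 2 + min (θ * g₀ / 4) (κ / 4) * Real.sin ((p.2.1 - p.2.2) / 2) ^ 2 := by ring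
    _ ≤ θ * g₀ / 4 * A p ^ 2 + κ / 4 * Real.sin ((p.2.1 - p.2.2) / 2) ^ 2 :=
        add_le_add (mul_le_mul_of_nonneg_right (min_le_left _ _) hA2)
          (mul_le_mul_of_nonneg_right (min_le_right _ _) hS2)

end Summit.AtomisticToContinuum.FouriersLaw.Theorems.DrudeDissolution.KineticPolymerGasOnTheTimeAxis

end
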